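import Summits.NavierStokesRegularity.NavierStokesRegularity.Theorems.PerpetualPumpThesisBesovFloorBoundEmbed
import Literature.Analysis.FluidPDE.CriticalRegularityProofs
import Literature.Analysis.FluidPDE.TaoMildSolutionBounds
import Summits.NavierStokesRegularity.NavierStokesRegularity.Theorems.PerpetualPumpThesisBesovFloorBoundBoot

/-!
# Stub F (`besovFloorBound`) for `PerpetualPump.Thesis`, part II: reduction to two a-priori estimates

Support file (part 2 of the stub `besovFloorBound` of line `SketchIdeator2`, crux
stmt-NavierStokesRegularity-1832). The stub says: for every averaging datum `𝒜` of Tao's averaged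
Navier–Stokes equation (T. Tao, J. Amer. Math. Soc. 29 (2016), §1.1) there is `ε(𝒜) > 0` such that
an `H¹⁰_df`-mild solution `u` on `[0,T)` whose Besov envelope amplitude
`√(T-t₀) ‖u(t₀)‖_{Ḃ⁰_{∞,1}}` is `≤ ε` at ONE time `t₀ < T` stays bounded in `H¹⁰` on `[0,T)`.

This file proves the stub **from two a-priori estimates on mild solutions**, isolating exactly the
analytic input that the tree lacks (registered sub-goal `stub_besovFloorBound_Reduction`):

* **(A) Besov a-priori bound** (the `Ḃ⁰_{∞,1}` Duhamel inequality; Bahouri–Chemin–Danchin 2011,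
  Lemma 2.4 + the paraproduct bound for `e^{σΔ}B̃`): for `0 ≤ t₁ ≤ t < T`,
  `‖u(t)‖_{Ḃ} ≤ C ‖u(t₁)‖_{Ḃ} + C √(t-t₁) (sup_{[t₁,t]} ‖u‖_{Ḃ})²`;
* **(B) tame a-priori bound** (the Moser-type `H¹⁰` Duhamel inequality): for `0 ≤ t₁ ≤ t < T`,
  `‖u(t)‖_{H¹⁰} ≤ ‖u(t₁)‖_{H¹⁰} + C (√(t-t₁) + (t-t₁)) (sup ‖u‖_{Ḃ}) (sup ‖u‖_{H¹⁰})`.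

Given (A) and (B) the argument is real-variable:

1. `t ↦ ‖u(t)‖_{Ḃ}` is finite and continuous on `[0,T)` (part I: `‖f‖_{Ḃ} ≤ C_E ‖f‖_{H¹⁰}` and
   `u ∈ C_t H¹⁰`), `F.continuousOn_besov_toReal`;
2. **continuity bootstrap** (`F.bootstrap_lt`): with `K = 2C‖u(t₀)‖_{Ḃ} + ε/√(T-t₀)` and
   `ε = 1/(4C(2C+1))`, (A) improves the bound `‖u‖_{Ḃ} < K` on `[t₀,t]` to `‖u(t)‖_{Ḃ} ≤ 3K/4`,
   so `‖u‖_{Ḃ} < K` on all of `[t₀,T)` (and `√(T-t₀) K ≤ (2C+1)ε`: the envelope stays small);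
3. **short-step iteration** (`F.le_two_mul_of_step`, `F.le_two_pow_mul_of_local`): with `δ` so
   small that `C(√δ+δ)K ≤ 1/2`, (B) gives `‖u(s)‖_{H¹⁰} ≤ 2‖u(t₁)‖_{H¹⁰}` on `[t₁, t₁+δ]`, hence
   `‖u(t)‖_{H¹⁰} ≤ 2^N ‖u(t₀)‖_{H¹⁰}` on `[t₀,T)` with `N = ⌈(T-t₀)/δ⌉`;
4. on `[0,t₀]` the `H¹⁰` norm is bounded by continuity and compactness.

## References

* T. Tao, J. Amer. Math. Soc. 29 (2016), 601–674, §1.1 (1.15).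
* H. Bahouri, J.-Y. Chemin, R. Danchin, *Fourier Analysis and Nonlinear PDE* (2011), §2.1, §5.6.
-/

noncomputable section

open MeasureTheory Set Filter Topology
open scoped ENNReal NNReal SchwartzMap

set_option linter.dupNamespace false

namespace Summit.NavierStokesRegularity.NavierStokesRegularity.Theorems.PerpetualPumpThesis.F

open Literature.Analysis.FluidPDE Literature.Analysis.FluidPDE.Tao2016
open Literature.Analysis.FunctionSpaces

/-! ### The Besov envelope along an `H¹⁰`-continuous curve -/

/-- The coercion `L2C → 𝓢'` is additive: `↑(x - y) = ↑x - ↑y`. -/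
theorem coe_sub_L2C (x y : L2C) :
    ((x - y : L2C) : 𝓢'(EuclideanSpace ℝ (Fin 3), EuclideanSpace ℂ (Fin 3))) =
      (x : 𝓢'(EuclideanSpace ℝ (Fin 3), EuclideanSpace ℂ (Fin 3))) -
        (y : 𝓢'(EuclideanSpace ℝ (Fin 3), EuclideanSpace ℂ (Fin 3))) := by
  rw [← Lp.toTemperedDistributionCLM_apply, ← Lp.toTemperedDistributionCLM_apply (f := x),
    ← Lp.toTemperedDistributionCLM_apply (f := y), map_sub]

/-- `‖x‖_{Ḃ} ≤ ‖y‖_{Ḃ} + ‖x - y‖_{Ḃ}` on `L2C` (triangle inequality for `Ḃ⁰_{∞,1}`). -/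
theorem besov_le_add_sub (x y : L2C) :
    eHomBesovNorm 0 ∞ 1 ((x : L2C) : 𝓢'(EuclideanSpace ℝ (Fin 3), EuclideanSpace ℂ (Fin 3))) ≤
      eHomBesovNorm 0 ∞ 1 ((y : L2C) : 𝓢'(EuclideanSpace ℝ (Fin 3), EuclideanSpace ℂ (Fin 3))) +
        eHomBesovNorm 0 ∞ 1
          ((x - y : L2C) : 𝓢'(EuclideanSpace ℝ (Fin 3), EuclideanSpace ℂ (Fin 3))) := by
  rw [coe_sub_L2C]
  exact eHomBesovNorm_le_add_sub 0 ∞ le_rfl _ _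

/-- **The Besov envelope is continuous along an `H¹⁰`-continuous curve** (real-valued form): if
`u` is `H¹⁰`-continuous on `I` with finite `H¹⁰` norms there, then
`t ↦ ‖u(t)‖_{Ḃ⁰_{∞,1}}` (finite by `H¹⁰ ⊂ Ḃ⁰_{∞,1}`) is continuous on `I`, since
`|‖u(t)‖_{Ḃ} - ‖u(t₀)‖_{Ḃ}| ≤ ‖u(t) - u(t₀)‖_{Ḃ} ≤ C_E ‖u(t) - u(t₀)‖_{H¹⁰} → 0`. -/
theorem continuousOn_besov_toReal {I : Set ℝ} {u : ℝ → L2C} (hu : ContinuousInH10On I u)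
    (hfin : ∀ t ∈ I, eFourierSobolevNorm 10 (u t) < ⊤) :
    ContinuousOn (fun t => (eHomBesovNorm 0 ∞ 1
      ((u t : L2C) : 𝓢'(EuclideanSpace ℝ (Fin 3), EuclideanSpace ℂ (Fin 3)))).toReal) I := by
  obtain ⟨C, hC⟩ := exists_eHomBesovNorm_le_H10
  have hbfin : ∀ t ∈ I, eHomBesovNorm 0 ∞ 1
      ((u t : L2C) : 𝓢'(EuclideanSpace ℝ (Fin 3), EuclideanSpace ℂ (Fin 3))) < ⊤ := fun t ht =>
    (hC (u t)).trans_lt (ENNReal.mul_lt_top ENNReal.coe_lt_top (hfin t ht))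
  intro t₀ ht₀
  rw [ContinuousWithinAt, Metric.tendsto_nhds]
  intro ε hε
  have hd : ∀ᶠ t in 𝓝[I] t₀,
      (C : ℝ≥0∞) * eFourierSobolevNorm 10 (u t - u t₀) < ENNReal.ofReal ε := by
    have h1 : Tendsto (fun t => (C : ℝ≥0∞) * eFourierSobolevNorm 10 (u t - u t₀)) (𝓝[I] t₀)
        (𝓝 ((C : ℝ≥0∞) * 0)) :=
      ENNReal.Tendsto.const_mul (hu t₀ ht₀) (Or.inr ENNReal.coe_ne_top)
    rw [mul_zero] at h1
    exact (tendsto_order.1 h1).2 _ (ENNReal.ofReal_pos.2 hε)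
  filter_upwards [hd, self_mem_nhdsWithin] with t h1 h2
  set bt := eHomBesovNorm 0 ∞ 1
    ((u t : L2C) : 𝓢'(EuclideanSpace ℝ (Fin 3), EuclideanSpace ℂ (Fin 3))) with hbt
  set b₀ := eHomBesovNorm 0 ∞ 1
    ((u t₀ : L2C) : 𝓢'(EuclideanSpace ℝ (Fin 3), EuclideanSpace ℂ (Fin 3))) with hb₀
  set d := eHomBesovNorm 0 ∞ 1
    ((u t - u t₀ : L2C) : 𝓢'(EuclideanSpace ℝ (Fin 3), EuclideanSpace ℂ (Fin 3))) with hdd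
  have hft : bt < ⊤ := hbfin t h2
  have hf₀ : b₀ < ⊤ := hbfin t₀ ht₀
  have hdlt : d < ENNReal.ofReal ε := (hC (u t - u t₀)).trans_lt h1
  have hdtop : d < ⊤ := hdlt.trans ENNReal.ofReal_lt_top
  have e1 : bt ≤ b₀ + d := besov_le_add_sub (u t) (u t₀)
  have e2 : b₀ ≤ bt + d := by
    have h := besov_le_add_sub (u t₀) (u t)
    have hsymm : eHomBesovNorm 0 ∞ 1
        ((u t₀ - u t : L2C) : 𝓢'(EuclideanSpace ℝ (Fin 3), EuclideanSpace ℂ (Fin 3))) = d := by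
      rw [hdd, coe_sub_L2C, coe_sub_L2C, eHomBesovNorm_sub_comm]
    rwa [hsymm] at h
  have hdr : d.toReal < ε := by
    rw [← ENNReal.ofReal_lt_ofReal_iff hε, ENNReal.ofReal_toReal hdtop.ne]
    exact hdlt
  rw [Real.dist_eq, abs_sub_lt_iff]
  constructor
  · have := ENNReal.toReal_mono (ENNReal.add_lt_top.2 ⟨hf₀, hdtop⟩).ne e1
    rw [ENNReal.toReal_add hf₀.ne hdtop.ne] at this
    linarith
  · have := ENNReal.toReal_mono (ENNReal.add_lt_top.2 ⟨hft, hdtop⟩).ne e2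
    rw [ENNReal.toReal_add hft.ne hdtop.ne] at this
    linarith

/-! ### The reduction -/

/-- **The Besov floor bound from the two a-priori estimates (A), (B)** (see the module
docstring): per datum `𝒜`, with `C ≥ 1` the constant of (A), `ε = 1/(4C(2C+1))` works. -/
theorem besovFloorBound_of_apriori (𝒜 : AveragingDatum)
    (hA : ∃ C : ℝ, 1 ≤ C ∧ ∀ (a : L2C) (T : ℝ) (u : ℝ → L2C),
      IsMildSolutionFor 𝒜.form a (Ico 0 T) u → ∀ t₁ t M : ℝ, 0 ≤ t₁ → t₁ ≤ t → t < T → 0 ≤ M →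
      (∀ s ∈ Icc t₁ t, eHomBesovNorm 0 ∞ 1
        ((u s : L2C) : 𝓢'(EuclideanSpace ℝ (Fin 3), EuclideanSpace ℂ (Fin 3))) ≤ ENNReal.ofReal M) →
      eHomBesovNorm 0 ∞ 1 ((u t : L2C) : 𝓢'(EuclideanSpace ℝ (Fin 3), EuclideanSpace ℂ (Fin 3))) ≤
        ENNReal.ofReal C *
            eHomBesovNorm 0 ∞ 1
              ((u t₁ : L2C) : 𝓢'(EuclideanSpace ℝ (Fin 3), EuclideanSpace ℂ (Fin 3))) +
          ENNReal.ofReal (C * Real.sqrt (t - t₁) * M ^ 2))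
    (hB : ∃ C : ℝ, 0 ≤ C ∧ ∀ (a : L2C) (T : ℝ) (u : ℝ → L2C),
      IsMildSolutionFor 𝒜.form a (Ico 0 T) u → ∀ t₁ t M R : ℝ, 0 ≤ t₁ → t₁ ≤ t → t < T → 0 ≤ M →
      0 ≤ R →
      (∀ s ∈ Icc t₁ t, eHomBesovNorm 0 ∞ 1
        ((u s : L2C) : 𝓢'(EuclideanSpace ℝ (Fin 3), EuclideanSpace ℂ (Fin 3))) ≤ ENNReal.ofReal M) →
      (∀ s ∈ Icc t₁ t, eFourierSobolevNorm 10 (u s) ≤ ENNReal.ofReal R) →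
      eFourierSobolevNorm 10 (u t) ≤
        eFourierSobolevNorm 10 (u t₁) +
          ENNReal.ofReal (C * (Real.sqrt (t - t₁) + (t - t₁)) * M * R)) :
    ∃ ε : ℝ, 0 < ε ∧
      ∀ u₀ : 𝓢(EuclideanSpace ℝ (Fin 3), EuclideanSpace ℝ (Fin 3)), VectorCalculus.IsDivFree ⇑u₀ →
      ∀ T : ℝ, 0 < T → ∀ u : ℝ → L2C,
        𝒜.IsMildSolution (schwartzL2 u₀) (Ico 0 T) u →
        (∃ t₀ ∈ Ico 0 T, ENNReal.ofReal (Real.sqrt (T - t₀)) *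
            eHomBesovNorm 0 ∞ 1
              ((u t₀ : L2C) : 𝓢'(EuclideanSpace ℝ (Fin 3), EuclideanSpace ℂ (Fin 3))) ≤
              ENNReal.ofReal ε) →
        ∃ C : ℝ, ∀ t ∈ Ico 0 T, eFourierSobolevNorm 10 (u t) ≤ ENNReal.ofReal C := by
  obtain ⟨CA, hCA, hA⟩ := hA
  obtain ⟨CB, hCB, hB⟩ := hB
  have hCA0 : 0 < CA := by linarith
  set ε : ℝ := 1 / (4 * CA * (2 * CA + 1)) with hε
  have hε0 : 0 < ε := by positivity
  refine ⟨ε, hε0, fun u₀ _ T hT u hu hdip => ?_⟩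
  obtain ⟨t₀, ht₀, hsmall⟩ := hdip
  have hu' : IsMildSolutionFor 𝒜.form (schwartzL2 u₀) (Ico 0 T) u := hu
  have hfinH : ∀ s ∈ Ico 0 T, eFourierSobolevNorm 10 (u s) < ⊤ := fun s hs => (hu'.1 s hs).1
  have hcontH : ContinuousInH10On (Ico 0 T) u := hu'.2.1
  obtain ⟨CE, hCE⟩ := exists_eHomBesovNorm_le_H10
  -- notation: `b s = ‖u s‖_{Ḃ}`, `β`, `η` the real-valued envelope and `H¹⁰` norm
  set b : ℝ → ℝ≥0∞ := fun s => eHomBesovNorm 0 ∞ 1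
    ((u s : L2C) : 𝓢'(EuclideanSpace ℝ (Fin 3), EuclideanSpace ℂ (Fin 3))) with hb
  have hfinB : ∀ s ∈ Ico 0 T, b s < ⊤ := fun s hs =>
    (hCE (u s)).trans_lt (ENNReal.mul_lt_top ENNReal.coe_lt_top (hfinH s hs))
  set β : ℝ → ℝ := fun s => (b s).toReal with hβ
  set η : ℝ → ℝ := fun s => (eFourierSobolevNorm 10 (u s)).toReal with hη
  have hbβ : ∀ s ∈ Ico 0 T, b s = ENNReal.ofReal (β s) := fun s hs =>
    (ENNReal.ofReal_toReal (hfinB s hs).ne).symm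
  have hHη : ∀ s ∈ Ico 0 T, eFourierSobolevNorm 10 (u s) = ENNReal.ofReal (η s) := fun s hs =>
    (ENNReal.ofReal_toReal (hfinH s hs).ne).symm
  have hβ0 : ∀ s, 0 ≤ β s := fun s => ENNReal.toReal_nonneg
  have hη0 : ∀ s, 0 ≤ η s := fun s => ENNReal.toReal_nonneg
  have hβcont : ContinuousOn β (Ico 0 T) := continuousOn_besov_toReal hcontH hfinH
  have hηcont : ContinuousOn η (Ico 0 T) := hcontH.continuousOn_toReal hfinH
  have hIco : Ico t₀ T ⊆ Ico 0 T := fun s hs => ⟨ht₀.1.trans hs.1, hs.2⟩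
  -- the smallness at `t₀` in real numbers
  set τ : ℝ := T - t₀ with hτ
  have hτ0 : 0 < τ := by rw [hτ]; linarith [ht₀.2]
  have hsq0 : 0 < Real.sqrt τ := Real.sqrt_pos.2 hτ0
  set b₀ : ℝ := β t₀ with hb₀def
  have hb₀0 : 0 ≤ b₀ := hβ0 t₀
  have hsmall' : Real.sqrt τ * b₀ ≤ ε := by
    have h : ENNReal.ofReal (Real.sqrt τ * b₀) ≤ ENNReal.ofReal ε := by
      rw [ENNReal.ofReal_mul hsq0.le, ← hbβ t₀ (hIco ⟨le_rfl, ht₀.2⟩)]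
      exact hsmall
    exact (ENNReal.ofReal_le_ofReal_iff hε0.le).1 h
  -- Step 2: the Besov bootstrap, `β < K` on `[t₀, T)`
  set K : ℝ := 2 * CA * b₀ + ε / Real.sqrt τ with hK
  have hK0 : 0 < K := by positivity
  have hKb₀ : b₀ < K := by
    have : 0 < ε / Real.sqrt τ := by positivity
    nlinarith
  have hsqK : Real.sqrt τ * K ≤ (2 * CA + 1) * ε := by
    rw [hK, mul_add, mul_div_cancel₀ _ hsq0.ne']
    nlinarith
  have hq : CA * b₀ + CA * Real.sqrt τ * K ^ 2 ≤ 3 / 4 * K := by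
    have h1 : CA * b₀ ≤ K / 2 := by
      rw [hK]
      have : 0 ≤ ε / Real.sqrt τ := by positivity
      nlinarith
    have h2 : CA * Real.sqrt τ * K ^ 2 ≤ K / 4 := by
      have h3 : CA * Real.sqrt τ * K ^ 2 = CA * (Real.sqrt τ * K) * K := by ring
      have h4 : CA * (Real.sqrt τ * K) ≤ CA * ((2 * CA + 1) * ε) :=
        mul_le_mul_of_nonneg_left hsqK hCA0.le
      have h5 : CA * ((2 * CA + 1) * ε) = 1 / 4 := by
        rw [hε]
        field_simp
      rw [h3]
      nlinarith
    linarith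
  have hβK : ∀ t ∈ Ico t₀ T, β t < K := by
    refine bootstrap_lt (hβcont.mono hIco) hKb₀ (by nlinarith : 3 / 4 * K < K) ?_
    intro t ht hbound
    -- apply (A) on `[t₀, t]` with the bound `K`
    have hM : ∀ s ∈ Icc t₀ t, b s ≤ ENNReal.ofReal K := by
      intro s hs
      rw [hbβ s (hIco ⟨hs.1, hs.2.trans_lt ht.2⟩)]
      exact ENNReal.ofReal_le_ofReal (hbound s hs).le
    have hAt : b t ≤ ENNReal.ofReal CA * b t₀ + ENNReal.ofReal (CA * Real.sqrt (t - t₀) * K ^ 2) :=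
      hA (schwartzL2 u₀) T u hu' t₀ t K ht₀.1 ht.1 ht.2 hK0.le hM
    -- convert to real numbers
    have htI : t ∈ Ico 0 T := hIco ht
    rw [hbβ t htI, hbβ t₀ (hIco ⟨le_rfl, ht₀.2⟩), ← ENNReal.ofReal_mul (by linarith),
      ← ENNReal.ofReal_add (by positivity) (by positivity)] at hAt
    have hreal := (ENNReal.ofReal_le_ofReal_iff (by positivity)).1 hAt
    have hsqt : Real.sqrt (t - t₀) ≤ Real.sqrt τ := Real.sqrt_le_sqrt (by rw [hτ]; linarith [ht.2])
    calc β t ≤ CA * b₀ + CA * Real.sqrt (t - t₀) * K ^ 2 := by rw [hb₀def]; linarith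
      _ ≤ CA * b₀ + CA * Real.sqrt τ * K ^ 2 := by gcongr
      _ ≤ 3 / 4 * K := hq
  have hbK : ∀ s ∈ Ico t₀ T, b s ≤ ENNReal.ofReal K := fun s hs => by
    rw [hbβ s (hIco hs)]
    exact ENNReal.ofReal_le_ofReal (hβK s hs).le
  -- Step 3: the `H¹⁰` iteration
  set δ : ℝ := (1 / (4 * (CB * K + 1))) ^ 2 with hδ
  have hCBK : 0 < CB * K + 1 := by positivity
  have hδ0 : 0 < δ := by positivity
  have hsqδ : Real.sqrt δ = 1 / (4 * (CB * K + 1)) := by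
    rw [hδ, Real.sqrt_sq (by positivity)]
  have hδle : δ ≤ Real.sqrt δ := by
    rw [hsqδ, hδ]
    have h1 : 1 / (4 * (CB * K + 1)) ≤ 1 := by
      rw [div_le_one (by positivity)]
      nlinarith
    have h0 : 0 ≤ 1 / (4 * (CB * K + 1)) := by positivity
    nlinarith
  have hhalf : CB * (Real.sqrt δ + δ) * K ≤ 1 / 2 := by
    calc CB * (Real.sqrt δ + δ) * K ≤ CB * (2 * Real.sqrt δ) * K := by
          gcongr
          linarith
      _ = CB * K * (2 / (4 * (CB * K + 1))) := by rw [hsqδ]; ring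
      _ ≤ 1 / 2 := by
          have hx : 0 ≤ CB * K := mul_nonneg hCB hK0.le
          have hpos : 0 < 4 * (CB * K + 1) := by positivity
          rw [← mul_div_assoc, div_le_iff₀ hpos]
          linarith
  -- one step: `η ≤ 2 η(t₁)` on `[t₁, t₁ + δ]`
  have hloc : ∀ t₁ ∈ Ico t₀ T, ∀ s ∈ Ico t₀ T, t₁ ≤ s → s ≤ t₁ + δ → η s ≤ 2 * η t₁ := by
    intro t₁ ht₁ s hs h1s hsδ
    -- a priori bound `R₀` on `[t₁, s]` by continuity
    have hsubI : Icc t₁ s ⊆ Ico 0 T := fun r hr => ⟨(hIco ht₁).1.trans hr.1, hr.2.trans_lt hs.2⟩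
    obtain ⟨R₀, hR₀⟩ := isCompact_Icc.exists_bound_of_continuousOn (hηcont.mono hsubI)
    have hR₀' : ∀ r ∈ Icc t₁ s, η r ≤ max R₀ 0 := fun r hr => by
      have h := hR₀ r hr
      rw [Real.norm_eq_abs, abs_le] at h
      exact h.2.trans (le_max_left _ _)
    refine le_two_mul_of_step (hη0 t₁) (le_max_right _ _) hR₀' ?_ s (right_mem_Icc.2 h1s)
    intro R hR hbd r hr
    -- apply (B) on `[t₁, r]`
    have hrT : r < T := hr.2.trans_lt hs.2
    have hMB : ∀ x ∈ Icc t₁ r, b x ≤ ENNReal.ofReal K := fun x hx =>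
      hbK x ⟨ht₁.1.trans hx.1, hx.2.trans_lt hrT⟩
    have hRB : ∀ x ∈ Icc t₁ r, eFourierSobolevNorm 10 (u x) ≤ ENNReal.ofReal R := fun x hx => by
      rw [hHη x ⟨(hIco ht₁).1.trans hx.1, hx.2.trans_lt hrT⟩]
      exact ENNReal.ofReal_le_ofReal (hbd x ⟨hx.1, hx.2.trans hr.2⟩)
    have hBt : eFourierSobolevNorm 10 (u r) ≤ eFourierSobolevNorm 10 (u t₁) +
        ENNReal.ofReal (CB * (Real.sqrt (r - t₁) + (r - t₁)) * K * R) :=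
      hB (schwartzL2 u₀) T u hu' t₁ r K R (hIco ht₁).1 hr.1 hrT hK0.le hR hMB hRB
    have hrI : r ∈ Ico 0 T := ⟨(hIco ht₁).1.trans hr.1, hrT⟩
    have hrt₁ : r - t₁ ≤ δ := by linarith [hr.2]
    have hrt₁0 : 0 ≤ r - t₁ := by linarith [hr.1]
    have hnn : 0 ≤ CB * (Real.sqrt (r - t₁) + (r - t₁)) * K * R :=
      mul_nonneg (mul_nonneg (mul_nonneg hCB (add_nonneg (Real.sqrt_nonneg _) hrt₁0)) hK0.le) hR
    rw [hHη r hrI, hHη t₁ (hIco ht₁), ← ENNReal.ofReal_add (hη0 t₁) hnn] at hBt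
    have hreal := (ENNReal.ofReal_le_ofReal_iff (add_nonneg (hη0 t₁) hnn)).1 hBt
    have hfac : CB * (Real.sqrt (r - t₁) + (r - t₁)) * K * R ≤ R / 2 := by
      have h1 : Real.sqrt (r - t₁) + (r - t₁) ≤ Real.sqrt δ + δ :=
        add_le_add (Real.sqrt_le_sqrt hrt₁) hrt₁
      calc CB * (Real.sqrt (r - t₁) + (r - t₁)) * K * R ≤ CB * (Real.sqrt δ + δ) * K * R := by
            gcongr
        _ ≤ 1 / 2 * R := by gcongr
        _ = R / 2 := by ring
    linarith
  -- `η ≤ 2^N η(t₀)` on `[t₀, T)`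
  obtain ⟨N, hN⟩ : ∃ N : ℕ, τ ≤ N * δ := by
    obtain ⟨N, hN⟩ := exists_nat_ge (τ / δ)
    exact ⟨N, by rwa [div_le_iff₀ hδ0] at hN⟩
  have hηN : ∀ s ∈ Ico t₀ T, η s ≤ 2 ^ N * η t₀ := fun s hs =>
    le_two_pow_mul_of_local hδ0 (hη0 t₀) hloc N s hs (by rw [hτ] at hN; linarith [hs.2])
  -- Step 4: `[0, t₀]` by compactness, and assembly
  have hsub0 : Icc 0 t₀ ⊆ Ico 0 T := fun r hr => ⟨hr.1, hr.2.trans_lt ht₀.2⟩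
  obtain ⟨R₁, hR₁⟩ := isCompact_Icc.exists_bound_of_continuousOn (hηcont.mono hsub0)
  refine ⟨max R₁ (2 ^ N * η t₀), fun t ht => ?_⟩
  rw [hHη t ht]
  refine ENNReal.ofReal_le_ofReal ?_
  rcases le_or_gt t t₀ with h | h
  · have h1 := hR₁ t ⟨ht.1, h⟩
    rw [Real.norm_eq_abs, abs_le] at h1
    exact h1.2.trans (le_max_left _ _)
  · exact (hηN t ⟨h.le, ht.2⟩).trans (le_max_right _ _)

end Summit.NavierStokesRegularity.NavierStokesRegularity.Theorems.PerpetualPumpThesis.F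

namespace Summit.NavierStokesRegularity.NavierStokesRegularity.Theorems.PerpetualPumpThesis

open Literature.Analysis.FluidPDE Literature.Analysis.FluidPDE.Tao2016
open Literature.Analysis.FunctionSpaces

/-- **Part Reduction of stub F (registered sub-goal `stub_besovFloorBound_Reduction`)**: for every
averaging datum `𝒜`, the Besov a-priori bound (A) and the tame a-priori bound (B) for the
`H¹⁰_df`-mild solutions of `𝒜` (see the module docstring) imply the Besov floor bound
`stub_besovFloorBound` for `𝒜`: there is `ε > 0` such that a mild solution on `[0,T)` from Schwartz
divergence-free data with `√(T-t₀)‖u(t₀)‖_{Ḃ⁰_{∞,1}} ≤ ε` at one `t₀ < T` is `H¹⁰`-bounded on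
`[0,T)`. -/
theorem stub_besovFloorBound_Reduction : ∀ 𝒜 : AveragingDatum, (∃ C : ℝ, 1 ≤ C ∧ ∀ (a : L2C) (T : ℝ) (u : ℝ → L2C), IsMildSolutionFor 𝒜.form a (Ico 0 T) u → ∀ t₁ t M : ℝ, 0 ≤ t₁ → t₁ ≤ t → t < T → 0 ≤ M → (∀ s ∈ Icc t₁ t, eHomBesovNorm 0 ⊤ 1 ((u s : L2C) : 𝓢'(EuclideanSpace ℝ (Fin 3), EuclideanSpace ℂ (Fin 3))) ≤ ENNReal.ofReal M) → eHomBesovNorm 0 ⊤ 1 ((u t : L2C) : 𝓢'(EuclideanSpace ℝ (Fin 3), EuclideanSpace ℂ (Fin 3))) ≤ ENNReal.ofReal C * eHomBesovNorm 0 ⊤ 1 ((u t₁ : L2C) : 𝓢'(EuclideanSpace ℝ (Fin 3), EuclideanSpace ℂ (Fin 3))) + ENNReal.ofReal (C * Real.sqrt (t - t₁) * M ^ 2)) → (∃ C : ℝ, 0 ≤ C ∧ ∀ (a : L2C) (T : ℝ) (u : ℝ → L2C), IsMildSolutionFor 𝒜.form a (Ico 0 T) u → ∀ t₁ t M R : ℝ,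 0 ≤ t₁ → t₁ ≤ t → t < T → 0 ≤ M → 0 ≤ R → (∀ s ∈ Icc t₁ t, eHomBesovNorm 0 ⊤ 1 ((u s : L2C) : 𝓢'(EuclideanSpace ℝ (Fin 3), EuclideanSpace ℂ (Fin 3))) ≤ ENNReal.ofReal M) → (∀ s ∈ Icc t₁ t, eFourierSobolevNorm 10 (u s) ≤ ENNReal.ofReal R) → eFourierSobolevNorm 10 (u t) ≤ eFourierSobolevNorm 10 (u t₁) + ENNReal.ofReal (C * (Real.sqrt (t - t₁) + (t - t₁)) * M * R)) → ∃ ε : ℝ, 0 < ε ∧ ∀ u₀ : 𝓢(EuclideanSpace ℝ (Fin 3), EuclideanSpace ℝ (Fin 3)), VectorCalculus.IsDivFree ⇑u₀ → ∀ T : ℝ, 0 < T → ∀ u : ℝ → L2C, 𝒜.IsMildSolution (schwartzL2 u₀) (Ico 0 T) u → (∃ t₀ ∈ Ico 0 T, ENNReal.ofReal (Real.sqrt (T - t₀)) * eHomBesovNorm 0 ⊤ 1 ((u t₀ : L2C) : 𝓢'(EuclideanSpace ℝ (Fin 3), EuclideanSpace ℂ (Fin 3))) ≤ ENNReal.ofReal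 ε) → ∃ C : ℝ, ∀ t ∈ Ico 0 T, eFourierSobolevNorm 10 (u t) ≤ ENNReal.ofReal C :=
  fun 𝒜 hA hB => F.besovFloorBound_of_apriori 𝒜 hA hB

end Summit.NavierStokesRegularity.NavierStokesRegularity.Theorems.PerpetualPumpThesis
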